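import Mathlib
import HarnessLib
import Summits.ResolutionOfSingularities.ResolutionOfSingularities.Theorems.RadicialJungCleanModelsLens5UnimodularRefinement2

/-!
# Unimodular refinement (lens 5, part 3)
Port of `Cruxes/DescentPerfectToAll/Lens5_UnimodularRefinement.lean` (author: res-B-lens-5 g9/g10).
Part 3: Rational-ray case `ρ = 1` (rank-two kernel) and class (B)/(C) toric lemmas. Pure lattice combinatorics.
Main results: `exists_kernel_adapted_basis_of_rank_two_ker{,_pos}`, `toric_lemma_classB`, `toric_lemma_classC`.
-/

noncomputable section

set_option linter.dupNamespace false

namespace Summit.ResolutionOfSingularities.ResolutionOfSingularities.Theorems.RadicialJung.CleanModels.Lens5.UnimodularRefinement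

/-- Given two distinct indices in `Fin 3`, there is a third. -/
lemma fin3_third (i i₀ : Fin 3) (h : i ≠ i₀) : ∃ k : Fin 3, k ≠ i ∧ k ≠ i₀ := by
  revert i i₀; decide

/-- Case analysis for `Fin 3`: every element is one of the three given distinct elements. -/
lemma fin3_cases (i i₀ k : Fin 3) (hi : i ≠ i₀) (hk : k ≠ i) (hk₀ : k ≠ i₀) : ∀ j : Fin 3, j = i ∨ j = i₀ ∨ j = k := by
  revert i i₀ k; decide

/-- When the kernel has rank two, one basis vector carries all the weight. -/
theorem exists_kernel_adapted_basis_of_rank_two_ker {L : Type} [AddCommGroup L] (b : Module.Basis (Fin 3) ℤ L) {W : Type}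
    [AddCommGroup W] [NoZeroSMulDivisors ℤ W] (φ : L →+ W) (h0 : ∃ x : L, φ x ≠ 0)
    (h2 : ∃ x y : L, φ x = 0 ∧ φ y = 0 ∧ ∀ s t : ℤ, s • x + t • y = 0 → s = 0 ∧ t = 0) :
    ∃ (e : Module.Basis (Fin 3) ℤ L) (i₀ : Fin 3), φ (e i₀) ≠ 0 ∧ (∀ i, i ≠ i₀ → φ (e i) = 0) ∧
      ∀ f : L, φ f = e.repr f i₀ • φ (e i₀) := by
  classical
  let N : Submodule ℤ L := LinearMap.ker φ.toIntLinearMap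
  have hN : ∀ x : L, x ∈ N ↔ φ x = 0 := fun x => by
    simp only [N, LinearMap.mem_ker, AddMonoidHom.coe_toIntLinearMap]
  obtain ⟨n, snf⟩ := Submodule.smithNormalForm b N
  have hfi : ∀ i : Fin n, φ (snf.bM (snf.f i)) = 0 := by
    intro i
    have hmem : ((snf.bN i : N) : L) ∈ N := (snf.bN i).2
    rw [hN, snf.snf i, map_zsmul] at hmem
    have hai : snf.a i ≠ 0 := by
      intro h0'
      have h0'' : ((snf.bN i : N) : L) = 0 := by rw [snf.snf i, h0', zero_smul]
      exact snf.bN.ne_zero i (Subtype.ext h0'')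
    exact (smul_eq_zero.mp hmem).resolve_left hai
  -- some index is NOT in the range of `f` (else `φ = 0`)
  obtain ⟨i₀, hi₀⟩ : ∃ i₀ : Fin 3, i₀ ∉ Set.range snf.f := by
    by_contra hall
    push Not at hall
    obtain ⟨x, hx⟩ := h0
    apply hx
    have hrepr : x = ∑ i, snf.bM.repr x i • snf.bM i := (snf.bM.sum_repr x).symm
    rw [hrepr, map_sum]
    refine Finset.sum_eq_zero fun i _ => ?_
    obtain ⟨j, hj⟩ := hall i
    rw [map_zsmul, ← hj, hfi j, smul_zero]
  -- every other index IS in the range of `f` (else two coordinates vanish on `N`, contradicting rank two)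
  have hother : ∀ i, i ≠ i₀ → i ∈ Set.range snf.f := by
    intro i hi
    by_contra hi'
    obtain ⟨x, y, hx, hy, hind⟩ := h2
    have hxN : x ∈ N := (hN x).mpr hx
    have hyN : y ∈ N := (hN y).mpr hy
    -- on `N` the coordinates `i` and `i₀` vanish, so `N` sits in the line spanned by the third basis vector `bM k`
    have hx0 : snf.bM.repr x i = 0 := snf.repr_eq_zero_of_notMem_range ⟨x, hxN⟩ hi'
    have hx1 : snf.bM.repr x i₀ = 0 := snf.repr_eq_zero_of_notMem_range ⟨x, hxN⟩ hi₀
    have hy0 : snf.bM.repr y i = 0 := snf.repr_eq_zero_of_notMem_range ⟨y, hyN⟩ hi'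
    have hy1 : snf.bM.repr y i₀ = 0 := snf.repr_eq_zero_of_notMem_range ⟨y, hyN⟩ hi₀
    obtain ⟨k, hk, hk₀⟩ : ∃ k : Fin 3, k ≠ i ∧ k ≠ i₀ := fin3_third i i₀ hi
    have hcoord : ∀ z : L, snf.bM.repr z i = 0 → snf.bM.repr z i₀ = 0 → z = snf.bM.repr z k • snf.bM k := by
      intro z hz hz₀
      have hrepr : z = ∑ j, snf.bM.repr z j • snf.bM j := (snf.bM.sum_repr z).symm
      conv_lhs => rw [hrepr]
      rw [Fin.sum_univ_three]
      have hcases : ∀ j : Fin 3, j = i ∨ j = i₀ ∨ j = k := fin3_cases i i₀ k hi hk hk₀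
      -- kill the two vanishing coordinates, keep `k`
      have hjz : ∀ j : Fin 3, j ≠ k → snf.bM.repr z j • snf.bM j = 0 := by
        intro j hjk
        rcases hcases j with rfl | rfl | rfl
        · rw [hz, zero_smul]
        · rw [hz₀, zero_smul]
        · exact absurd rfl hjk
      fin_cases k
      · rw [hjz 1 (by decide), hjz 2 (by decide)]; simp
      · rw [hjz 0 (by decide), hjz 2 (by decide)]; simp
      · rw [hjz 0 (by decide), hjz 1 (by decide)]; simp
    obtain ⟨cx, hx'⟩ : ∃ c : ℤ, x = c • snf.bM k := ⟨_, hcoord x hx0 hx1⟩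
    obtain ⟨cy, hy'⟩ : ∃ c : ℤ, y = c • snf.bM k := ⟨_, hcoord y hy0 hy1⟩
    -- dependence: `cy • x - cx • y = 0`
    have hrel : cy • x + (-cx) • y = 0 := by
      rw [hx', hy', smul_smul, smul_smul, ← add_smul]
      have : cy * cx + -cx * cy = 0 := by ring
      rw [this, zero_smul]
    obtain ⟨-, ht⟩ := hind _ _ hrel
    have hxk : cx = 0 := by simpa using ht
    have hx0' : x = 0 := by rw [hx', hxk, zero_smul]
    have := hind 1 0 (by rw [hx0', smul_zero, zero_smul, add_zero])
    exact one_ne_zero this.1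
  refine ⟨snf.bM, i₀, ?_, ?_, ?_⟩
  · -- `φ (bM i₀) ≠ 0`: else `φ = 0`
    intro hφ0
    obtain ⟨x, hx⟩ := h0
    apply hx
    have hrepr : x = ∑ i, snf.bM.repr x i • snf.bM i := (snf.bM.sum_repr x).symm
    rw [hrepr, map_sum]
    refine Finset.sum_eq_zero fun i _ => ?_
    rw [map_zsmul]
    by_cases hi : i = i₀
    · rw [hi, hφ0, smul_zero]
    · obtain ⟨j, hj⟩ := hother i hi
      rw [← hj, hfi j, smul_zero]
  · intro i hi
    obtain ⟨j, hj⟩ := hother i hi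
    rw [← hj]; exact hfi j
  · intro f
    have hrepr : f = ∑ i, snf.bM.repr f i • snf.bM i := (snf.bM.sum_repr f).symm
    conv_lhs => rw [hrepr]
    rw [map_sum, Finset.sum_eq_single i₀]
    · rw [map_zsmul]
    · intro i _ hi
      obtain ⟨j, hj⟩ := hother i hi
      rw [map_zsmul, ← hj, hfi j, smul_zero]
    · intro h; exact absurd (Finset.mem_univ _) h

/-- With ordered values: after a sign the weight-carrying vector has positive weight, and every `f` of positive weight a positive coordinate. -/
theorem exists_kernel_adapted_basis_of_rank_two_ker_pos {L : Type} [AddCommGroup L] (b : Module.Basis (Fin 3) ℤ L) {W : Type}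
    [AddCommGroup W] [LinearOrder W] [IsOrderedAddMonoid W] (φ : L →+ W) (h0 : ∃ x : L, φ x ≠ 0)
    (h2 : ∃ x y : L, φ x = 0 ∧ φ y = 0 ∧ ∀ s t : ℤ, s • x + t • y = 0 → s = 0 ∧ t = 0) :
    ∃ (e : Module.Basis (Fin 3) ℤ L) (i₀ : Fin 3), 0 < φ (e i₀) ∧ (∀ i, i ≠ i₀ → φ (e i) = 0) ∧
      (∀ f : L, φ f = e.repr f i₀ • φ (e i₀)) ∧ ∀ f : L, 0 < φ f → 0 < e.repr f i₀ := by
  obtain ⟨e, i₀, hne, hker, hcoord⟩ := exists_kernel_adapted_basis_of_rank_two_ker b φ h0 h2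
  -- sign
  obtain ⟨ε, hε, hpos⟩ : ∃ ε : ℤˣ, (ε = 1 ∨ ε = -1) ∧ 0 < (ε : ℤ) • φ (e i₀) := by
    rcases lt_or_gt_of_ne hne with hlt | hgt
    · exact ⟨-1, Or.inr rfl, by simpa using hlt⟩
    · exact ⟨1, Or.inl rfl, by simpa using hgt⟩
  let w : Fin 3 → ℤˣ := fun i => if i = i₀ then ε else 1
  have hw : w i₀ = ε := by simp [w]
  have hεinv : ε⁻¹ = ε := by rcases hε with rfl | rfl <;> rfl
  refine ⟨e.unitsSMul w, i₀, ?_, ?_, ?_, ?_⟩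
  · rw [Module.Basis.unitsSMul_apply, hw, Units.smul_def, map_zsmul]; exact hpos
  · intro i hi
    rw [Module.Basis.unitsSMul_apply, Units.smul_def, map_zsmul, hker i hi, smul_zero]
  · intro f
    rw [Module.Basis.repr_unitsSMul, Module.Basis.unitsSMul_apply, hw, hεinv, Units.smul_def, Units.smul_def, map_zsmul,
      smul_smul, smul_eq_mul]
    have hεε : (ε : ℤ) * ε = 1 := by rcases hε with rfl | rfl <;> rfl
    rw [mul_comm ((ε : ℤ)) (e.repr f i₀), mul_assoc, hεε, mul_one]
    exact hcoord f
  · intro f hf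
    have key : φ f = ((e.unitsSMul w).repr f i₀) • ((ε : ℤ) • φ (e i₀)) := by
      rw [Module.Basis.repr_unitsSMul, hw, hεinv, Units.smul_def, smul_smul, smul_eq_mul]
      have hεε : (ε : ℤ) * ε = 1 := by rcases hε with rfl | rfl <;> rfl
      rw [mul_comm ((ε : ℤ)) (e.repr f i₀), mul_assoc, hεε, mul_one]
      exact hcoord f
    rw [key] at hf
    by_contra hle
    push Not at hle
    have : ((e.unitsSMul w).repr f i₀) • ((ε : ℤ) • φ (e i₀)) ≤ 0 :=
      smul_nonpos_of_nonpos_of_nonneg hle hpos.le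
    exact absurd hf (not_lt.mpr this)

/-! ## (rev 6) CLASS (B) TORIC LEMMA — complete lattice form (the dichotomy `ρ = 2` / `ρ = 1` packaged)

Input the port has: a rank-3 exponent lattice `L` (basis `b` = exponents of `s₁,s₂,s₃` or any basis), the monomial valuation
`φ : L →+ W` into the (archimedean, class (B)) value group, ONE non-trivial integer relation among the weights (from `rr Γ ≤ 2`, i.e. the
transcendence-defect hypothesis (htd) of the stub), and the finite set `F` of exponents of positive value that must become regular monomials.
Output: either (`ρ = 2`) an adapted triple `(m₁, m₂, e 2)` — `e` a basis with `φ(e 2) = 0`, `e 0, e 1 ∈ ℤm₁ + ℤm₂` unimodularly,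
`φ(m₁), φ(m₂) > 0`, every `f ∈ F` with explicit coordinates, the `m₁, m₂`-ones positive —, or (`ρ = 1`) a basis `e` and an index `i₀` with
`φ(e i₀) > 0`, `φ(e i) = 0 (i ≠ i₀)`, `φ f = (e.repr f i₀) • φ(e i₀)` and every `f` of positive value having positive `i₀`-coordinate. -/

/-- **CLASS (B) TORIC LEMMA** — complete lattice form. -/
theorem toric_lemma_classB {L : Type} [AddCommGroup L] (b : Module.Basis (Fin 3) ℤ L) {W : Type} [AddCommGroup W] [LinearOrder W]
    [IsOrderedAddMonoid W] [Archimedean W] (φ : L →+ W) (hrel : ∃ x : L, x ≠ 0 ∧ φ x = 0) (hne : ∃ x : L, φ x ≠ 0)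
    (F : Finset L) (hF : ∀ f ∈ F, 0 < φ f) :
    (∃ (e : Module.Basis (Fin 3) ℤ L) (m₁ m₂ : L) (a b' c d : ℤ), φ (e 2) = 0 ∧ (a * d - b' * c = 1 ∨ a * d - b' * c = -1) ∧
      e 0 = a • m₁ + b' • m₂ ∧ e 1 = c • m₁ + d • m₂ ∧ 0 < φ m₁ ∧ 0 < φ m₂ ∧
      (∀ f : L, φ f = 0 → e.repr f 0 = 0 ∧ e.repr f 1 = 0) ∧
      ∀ f ∈ F, f = (e.repr f 0 * a + e.repr f 1 * c) • m₁ + (e.repr f 0 * b' + e.repr f 1 * d) • m₂ + e.repr f 2 • e 2 ∧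
        0 < e.repr f 0 * a + e.repr f 1 * c ∧ 0 < e.repr f 0 * b' + e.repr f 1 * d) ∨
    (∃ (e : Module.Basis (Fin 3) ℤ L) (i₀ : Fin 3), 0 < φ (e i₀) ∧ (∀ i, i ≠ i₀ → φ (e i) = 0) ∧
      (∀ f : L, φ f = e.repr f i₀ • φ (e i₀)) ∧ ∀ f : L, 0 < φ f → 0 < e.repr f i₀) := by
  by_cases h2 : ∀ x y : L, φ x = 0 → φ y = 0 → ∃ s t : ℤ, (s ≠ 0 ∨ t ≠ 0) ∧ s • x + t • y = 0
  · left
    obtain ⟨e, hker, hind⟩ := exists_kernel_adapted_basis b φ hrel h2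
    obtain ⟨m₁, m₂, a, b', c, d, hdet, h0, h1, hm₁, hm₂, hcoord⟩ :=
      exists_adapted_basis_rank3_archimedean e φ hker hind F hF
    -- (rev 9) the kernel clause: `ker φ = ℤ · e 2`
    have hkc : ∀ f : L, φ f = 0 → e.repr f 0 = 0 ∧ e.repr f 1 = 0 := by
      intro f hf
      apply hind
      have hrepr : f = e.repr f 0 • e 0 + e.repr f 1 • e 1 + e.repr f 2 • e 2 := by
        conv_lhs => rw [← e.sum_repr f]
        rw [Fin.sum_univ_three]
      have h := hf
      rw [hrepr, map_add, map_add, map_zsmul, map_zsmul, map_zsmul, hker, smul_zero, add_zero] at h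
      exact h
    exact ⟨e, m₁, m₂, a, b', c, d, hker, hdet, h0, h1, hm₁, hm₂, hkc, hcoord⟩
  · right
    push Not at h2
    obtain ⟨x, y, hx, hy, hind⟩ := h2
    refine exists_kernel_adapted_basis_of_rank_two_ker_pos b φ hne ⟨x, y, hx, hy, fun s t hst => ?_⟩
    by_contra hnot
    rw [not_and_or] at hnot
    rcases hnot with hs | ht
    · exact hind s t (Or.inl hs) hst
    · exact hind s t (Or.inr ht) hst

/-! ## (rev 7) Class (C): the two-level (lexicographic) toric lemma, lattice form

Class (C) = the value group `Γ` has rank two (a proper convex subgroup `Δ`); `rr Γ = 2` by (htd).  On the exponent lattice `L ≅ ℤ³`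
the weight is then read through TWO integer functionals supplied by the port: `φ₁` = the class of the value in `Γ/Δ` and `φ₂` = a
`Δ`-coordinate (both identified with `ℤ` on the finitely generated image, a section chosen once); `v`-positivity of a monomial is
LEX-positivity `0 < φ₁ ∨ (φ₁ = 0 ∧ 0 < φ₂)`.  Internally this is the weight `Φ = (φ₁, φ₂) : L →+ ℤ ×ₗ ℤ`, a linearly ordered
(non-archimedean) group, so `exists_kernel_adapted_basis` and the `ρ = 1` branch apply verbatim; for `ρ = 2` the plane is refined by
`exists_unimodular_lex_refinement`.  Output: either (`ρ = 2`) an adapted basis `(m₁, m₂, e 2)` with `e 2` of weight zero, `m₁` of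
positive `φ₁`-weight, `m₂` of weight `(0, b₂)`, `b₂ > 0`, and every `f ∈ F` with non-negative `(m₁, m₂)`-coordinates that are
lex-positive (so some coordinate on a value-positive vector is positive — what §13(b) of the memo uses); or (`ρ = 1`) one basis vector
of positive weight carrying all the weight. -/

/-- **TORIC LEMMA, class (C) (two-level weights), lattice form, complete.** -/
theorem toric_lemma_classC {L : Type} [AddCommGroup L] (b : Module.Basis (Fin 3) ℤ L) (φ₁ φ₂ : L →+ ℤ)
    (hrel : ∃ x : L, x ≠ 0 ∧ φ₁ x = 0 ∧ φ₂ x = 0) (hne : ∃ x : L, φ₁ x ≠ 0 ∨ φ₂ x ≠ 0)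
    (F : Finset L) (hF : ∀ f ∈ F, 0 < φ₁ f ∨ (φ₁ f = 0 ∧ 0 < φ₂ f)) :
    (∃ (e : Module.Basis (Fin 3) ℤ L) (m₁ m₂ : L) (a b' c d : ℤ),
      (φ₁ (e 2) = 0 ∧ φ₂ (e 2) = 0) ∧ (a * d - b' * c = 1 ∨ a * d - b' * c = -1) ∧
      e 0 = a • m₁ + b' • m₂ ∧ e 1 = c • m₁ + d • m₂ ∧
      0 < φ₁ m₁ ∧ (φ₁ m₂ = 0 ∧ 0 < φ₂ m₂) ∧
      (∀ f : L, φ₁ f = 0 → φ₂ f = 0 → e.repr f 0 = 0 ∧ e.repr f 1 = 0) ∧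
      ∀ f ∈ F, f = (e.repr f 0 * a + e.repr f 1 * c) • m₁ + (e.repr f 0 * b' + e.repr f 1 * d) • m₂ + e.repr f 2 • e 2 ∧
        0 ≤ e.repr f 0 * a + e.repr f 1 * c ∧ 0 ≤ e.repr f 0 * b' + e.repr f 1 * d ∧
        (0 < e.repr f 0 * a + e.repr f 1 * c ∨
          (e.repr f 0 * a + e.repr f 1 * c = 0 ∧ 0 < e.repr f 0 * b' + e.repr f 1 * d))) ∨
    (∃ (e : Module.Basis (Fin 3) ℤ L) (i₀ : Fin 3),
      (0 < φ₁ (e i₀) ∨ (φ₁ (e i₀) = 0 ∧ 0 < φ₂ (e i₀))) ∧ (∀ i, i ≠ i₀ → φ₁ (e i) = 0 ∧ φ₂ (e i) = 0) ∧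
      (∀ f : L, φ₁ f = e.repr f i₀ * φ₁ (e i₀) ∧ φ₂ f = e.repr f i₀ * φ₂ (e i₀)) ∧
      ∀ f : L, (0 < φ₁ f ∨ (φ₁ f = 0 ∧ 0 < φ₂ f)) → 0 < e.repr f i₀) := by
  classical
  -- the lexicographic weight `Φ = (φ₁, φ₂) : L → ℤ ×ₗ ℤ`
  let Φ : L →+ ℤ ×ₗ ℤ :=
    { toFun := fun x => toLex (φ₁ x, φ₂ x)
      map_zero' := by simp only [map_zero]; rfl
      map_add' := fun x y => by simp only [map_add]; rfl }
  have hΦ : ∀ x, Φ x = toLex (φ₁ x, φ₂ x) := fun _ => rfl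
  have h0lex : (0 : ℤ ×ₗ ℤ) = toLex ((0 : ℤ), (0 : ℤ)) := rfl
  have hΦzero : ∀ x, Φ x = 0 ↔ φ₁ x = 0 ∧ φ₂ x = 0 := fun x => by
    rw [hΦ, h0lex, toLex_inj, Prod.mk.injEq]
  have hΦpos : ∀ x, 0 < Φ x ↔ 0 < φ₁ x ∨ (φ₁ x = 0 ∧ 0 < φ₂ x) := fun x => by
    rw [hΦ, h0lex, Prod.Lex.toLex_lt_toLex]
    exact or_congr Iff.rfl (and_congr eq_comm Iff.rfl)
  by_cases h2 : ∀ x y : L, Φ x = 0 → Φ y = 0 → ∃ s t : ℤ, (s ≠ 0 ∨ t ≠ 0) ∧ s • x + t • y = 0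
  · left
    obtain ⟨x₀, hx₀, hx₀1, hx₀2⟩ := hrel
    obtain ⟨e, hker, hind⟩ := exists_kernel_adapted_basis b Φ ⟨x₀, hx₀, (hΦzero x₀).mpr ⟨hx₀1, hx₀2⟩⟩ h2
    have hker' : φ₁ (e 2) = 0 ∧ φ₂ (e 2) = 0 := (hΦzero _).mp hker
    -- coordinates
    have hrepr : ∀ f : L, f = e.repr f 0 • e 0 + e.repr f 1 • e 1 + e.repr f 2 • e 2 := by
      intro f
      conv_lhs => rw [← e.sum_repr f]
      rw [Fin.sum_univ_three]
    have hφ₁ : ∀ f : L, φ₁ f = e.repr f 0 * φ₁ (e 0) + e.repr f 1 * φ₁ (e 1) := by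
      intro f
      conv_lhs => rw [hrepr f]
      rw [map_add, map_add, map_zsmul, map_zsmul, map_zsmul, hker'.1, smul_zero, add_zero, smul_eq_mul, smul_eq_mul]
    have hφ₂ : ∀ f : L, φ₂ f = e.repr f 0 * φ₂ (e 0) + e.repr f 1 * φ₂ (e 1) := by
      intro f
      conv_lhs => rw [hrepr f]
      rw [map_add, map_add, map_zsmul, map_zsmul, map_zsmul, hker'.2, smul_zero, add_zero, smul_eq_mul, smul_eq_mul]
    -- the two weight vectors are independent: non-zero determinant
    have hlin : ∀ u v : ℤ, u • Φ (e 0) + v • Φ (e 1) =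
        toLex (u * φ₁ (e 0) + v * φ₁ (e 1), u * φ₂ (e 0) + v * φ₂ (e 1)) := by
      intro u v
      rw [← map_zsmul Φ, ← map_zsmul Φ, ← map_add Φ, hΦ]
      simp only [map_add, map_zsmul, smul_eq_mul]
    have hdet : φ₁ (e 0) * φ₂ (e 1) - φ₁ (e 1) * φ₂ (e 0) ≠ 0 := by
      intro hdet
      have hq : φ₂ (e 1) = 0 ∧ -φ₂ (e 0) = 0 := by
        apply hind
        rw [hlin, h0lex, toLex_inj, Prod.mk.injEq]
        constructor
        · linear_combination hdet
        · ring
      have hp : φ₁ (e 1) = 0 ∧ -φ₁ (e 0) = 0 := by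
        apply hind
        rw [hlin, h0lex, toLex_inj, Prod.mk.injEq]
        constructor
        · ring
        · linear_combination (-1 : ℤ) * hdet
      have h10 : (1 : ℤ) = 0 ∧ (0 : ℤ) = 0 := by
        apply hind
        rw [hlin, h0lex, toLex_inj, Prod.mk.injEq, neg_eq_zero.mp hp.2, neg_eq_zero.mp hq.2]
        constructor <;> ring
      exact one_ne_zero h10.1
    -- the lexicographic plane refinement
    obtain ⟨a, b', c, d, g, b₁, b₂, hdet1, hg, hb₂, hp₁, hp₂, hq₁, hq₂, hnonneg⟩ :=
      exists_unimodular_lex_refinement (φ₁ (e 0)) (φ₁ (e 1)) (φ₂ (e 0)) (φ₂ (e 1)) hdet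
        (F.image fun f => (e.repr f 0, e.repr f 1))
        (by
          intro g hg
          obtain ⟨f, hf, rfl⟩ := Finset.mem_image.mp hg
          have h := hF f hf
          rw [hφ₁ f, hφ₂ f] at h
          exact h)
    -- the new basis vectors (inverse of the unimodular matrix, sign-corrected)
    obtain ⟨ε, hε, hεdet⟩ : ∃ ε : ℤ, (ε = 1 ∨ ε = -1) ∧ ε * (a * d - b' * c) = 1 := by
      rcases hdet1 with h | h
      · exact ⟨1, Or.inl rfl, by rw [h]; ring⟩
      · exact ⟨-1, Or.inr rfl, by rw [h]; ring⟩
    -- (rev 9) the kernel clause: `ker Φ = ℤ · e 2`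
    have hkc : ∀ f : L, φ₁ f = 0 → φ₂ f = 0 → e.repr f 0 = 0 ∧ e.repr f 1 = 0 := by
      intro f hf1 hf2
      apply hind
      rw [hlin, ← hφ₁ f, ← hφ₂ f, hf1, hf2]
      rfl
    refine ⟨e, ε • (d • e 0 - b' • e 1), ε • (-c • e 0 + a • e 1), a, b', c, d, hker', hdet1, ?_, ?_, ?_, ?_, hkc, ?_⟩
    · have : a • (ε • (d • e 0 - b' • e 1)) + b' • (ε • (-c • e 0 + a • e 1)) = (ε * (a * d - b' * c)) • e 0 := by
        module
      rw [this, hεdet, one_smul]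
    · have : c • (ε • (d • e 0 - b' • e 1)) + d • (ε • (-c • e 0 + a • e 1)) = (ε * (a * d - b' * c)) • e 1 := by
        module
      rw [this, hεdet, one_smul]
    · have : φ₁ (ε • (d • e 0 - b' • e 1)) = (ε * (a * d - b' * c)) * g := by
        rw [map_zsmul, map_sub, map_zsmul, map_zsmul, hp₁, hp₂]
        simp only [smul_eq_mul]
        ring
      rw [this, hεdet, one_mul]
      exact hg
    · constructor
      · have : φ₁ (ε • (-c • e 0 + a • e 1)) = 0 := by
          rw [map_zsmul, map_add, map_zsmul, map_zsmul, hp₁, hp₂]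
          simp only [smul_eq_mul]
          ring
        exact this
      · have : φ₂ (ε • (-c • e 0 + a • e 1)) = (ε * (a * d - b' * c)) * b₂ := by
          rw [map_zsmul, map_add, map_zsmul, map_zsmul, hq₁, hq₂]
          simp only [smul_eq_mul]
          ring
        rw [this, hεdet, one_mul]
        exact hb₂
    · intro f hf
      have hg' := hnonneg (e.repr f 0, e.repr f 1) (Finset.mem_image.mpr ⟨f, hf, rfl⟩)
      have key : (e.repr f 0 * a + e.repr f 1 * c) • (ε • (d • e 0 - b' • e 1)) +
          (e.repr f 0 * b' + e.repr f 1 * d) • (ε • (-c • e 0 + a • e 1)) =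
          (ε * (a * d - b' * c) * e.repr f 0) • e 0 + (ε * (a * d - b' * c) * e.repr f 1) • e 1 := by
        module
      have hdecomp : f = (e.repr f 0 * a + e.repr f 1 * c) • (ε • (d • e 0 - b' • e 1)) +
          (e.repr f 0 * b' + e.repr f 1 * d) • (ε • (-c • e 0 + a • e 1)) + e.repr f 2 • e 2 := by
        rw [key, hεdet, one_mul, one_mul]
        exact hrepr f
      refine ⟨hdecomp, hg'.1, hg'.2, ?_⟩
      have hφ₁f : φ₁ f = (e.repr f 0 * a + e.repr f 1 * c) * g := by
        rw [hφ₁ f, hp₁, hp₂]; ring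
      have hφ₂f : φ₂ f = (e.repr f 0 * a + e.repr f 1 * c) * b₁ + (e.repr f 0 * b' + e.repr f 1 * d) * b₂ := by
        rw [hφ₂ f, hq₁, hq₂]; ring
      rcases hF f hf with h | ⟨h1, h2⟩
      · left
        rw [hφ₁f] at h
        by_contra hC
        have hC0 : e.repr f 0 * a + e.repr f 1 * c = 0 := le_antisymm (not_lt.mp hC) hg'.1
        rw [hC0, zero_mul] at h
        exact lt_irrefl _ h
      · right
        have hC₁ : e.repr f 0 * a + e.repr f 1 * c = 0 := by
          rw [hφ₁f] at h1
          rcases mul_eq_zero.mp h1 with h | h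
          · exact h
          · exact absurd h hg.ne'
        refine ⟨hC₁, ?_⟩
        rw [hφ₂f, hC₁, zero_mul, zero_add] at h2
        by_contra hC
        have hC0 : e.repr f 0 * b' + e.repr f 1 * d = 0 := le_antisymm (not_lt.mp hC) hg'.2
        rw [hC0, zero_mul] at h2
        exact lt_irrefl _ h2
  · right
    push Not at h2
    obtain ⟨x, y, hx, hy, hind⟩ := h2
    have hind' : ∀ s t : ℤ, s • x + t • y = 0 → s = 0 ∧ t = 0 := by
      intro s t hst
      by_contra hnot
      rw [not_and_or] at hnot
      rcases hnot with hs | ht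
      · exact hind s t (Or.inl hs) hst
      · exact hind s t (Or.inr ht) hst
    obtain ⟨x₁, hx₁⟩ := hne
    have h0 : ∃ x : L, Φ x ≠ 0 := by
      refine ⟨x₁, fun h => ?_⟩
      rcases hx₁ with h' | h'
      · exact h' ((hΦzero x₁).mp h).1
      · exact h' ((hΦzero x₁).mp h).2
    obtain ⟨e, i₀, hpos, hker, hrepr, hposf⟩ :=
      exists_kernel_adapted_basis_of_rank_two_ker_pos b Φ h0 ⟨x, y, hx, hy, hind'⟩
    refine ⟨e, i₀, (hΦpos _).mp hpos, fun i hi => (hΦzero _).mp (hker i hi), fun f => ?_,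
      fun f hf => hposf f ((hΦpos f).mpr hf)⟩
    have h := hrepr f
    rw [← map_zsmul Φ, hΦ, hΦ, toLex_inj, Prod.mk.injEq, map_zsmul, map_zsmul, smul_eq_mul, smul_eq_mul] at h
    exact h

end Summit.ResolutionOfSingularities.ResolutionOfSingularities.Theorems.RadicialJung.CleanModels.Lens5.UnimodularRefinement
end
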